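import Summits.QuantumFields.YangMills.Theorems.AllWindowsColdBoxBoxHighLineGhostMSchur

/-!
# `GhostKernelEntries` (U5-BLOCKERS §2, lift L2) — the KERNEL form of the ghost quadratic form:
# `|M_H(i,j)| ≤ C / (1 + d(i,j))⁴`, uniformly in `H ≥ 1` (no logarithm)

Width seat `ym-line-sfw-p2-w3` (g41), cell ym-idea-1; U5 prep, helper-grade (planner ym-idea-2 g18 BOARD 2026-08-29T22:22:10Z,
«L2 open: exact Wick of the even part of f′(0) — ConnectedThreePoint + GhostKernelEntries»).

With `M_H = GhostFP.ghostM H` (✓`…GhostQuadForm`: `M_H(i,j) = −½·tr(X_iX_j) − [i=j]·½·tr(X_i^Q)`), the landed pairing decay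
✓`GhostFP.abs_trace_ghostX_edgeMat_mul_le` (`|tr(X_εX_ε')| ≤ 331776·‖M‖‖M'‖·C_G²·Σ_{z,w} endInd_ε(z)·endInd_ε'(w)/(1+d(z,w))⁴`), the single
trace ✓`abs_trace_ghostX_edgeMat_le` (`|tr X_ε| ≤ 288·C_G·‖M‖`) and the Dirichlet site Green's function bounds ✓`ghostKernelDecay`
(`0 ≤ G ≤ C_G/(1+d)²`) give:
* `abs_ghostM_le_endInd_of` / `abs_ghostM_le_endInd` — `|M_H(i,j)| ≤ 1492992·C_G²·Σ_{z,w} endInd_i(z)endInd_j(w)/(1+d(z,w))⁴ + [i=j]·144·C_G`;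
* `one_div_pow_four_le_of_endInd` — an endpoint `z` of the edge `ε` and an endpoint `w` of `ε'` satisfy `(1+d(z,w))⁻⁴ ≤ 81·(1+d(ε₋,ε'₋))⁻⁴`
  (`d` = the sup-distance ✓`siteDist`, `ε₋ = ε.1` the base point), hence `sum_endInd_mul_endInd_div_le`:
  `Σ_{z,w} endInd_ε(z)endInd_ε'(w)/(1+d(z,w))⁴ ≤ 324/(1+d(ε₋,ε'₋))⁴`;
* ★ `abs_ghostM_le` — **`∃ C ≥ 0, ∀ H ≥ 1, ∀ i j, |ghostM H i j| ≤ C/(1 + siteDist (base i) (base j))⁴`**.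
This is the entry decay the L2 ghost-vertex diagram `p₀ → M_H → p_T` of the connected three-point function consumes (two propagators
`∇G ~ (1+d)⁻³` through a `(1+d)⁻⁴` vertex kernel).  The row-sum (Schur) form `Σ_j |M_H(i,j)| ≤ C(1+log H)` is ✓`sum_abs_ghostM_le`.

Everything proved, no definitions, standard axioms.  HONEST LABEL: a tool for the RECORDED lift L2 of the NEXT rung U5
(⟨stmt-QuantumFields-24336⟩, UNSTAFFED); ⟨24004⟩ ⟨24336⟩ remain OPEN; route AllWindowsColdBox is DRAFT; no crux, rung or summit is proved;
**the Yang–Mills mass gap is NOT proved by this file; no summit is proved by a line.**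
-/

set_option autoImplicit false

noncomputable section

open Matrix Finset
open scoped Matrix.Norms.Operator
open Literature.MathematicalPhysics.QuantumFieldTheory.Balaban1983to89.B10Eq18SigmaSU2 (su2Coord)
open Literature.MathematicalPhysics.QuantumLattice (LGConfig ZdEdge)
open Literature.Probability.LatticeModels (Site dirichletMatrix)

namespace Summit.QuantumFields.YangMills.Theorems.AllWindowsColdBoxBoxHighLine

namespace GhostFP

open EdgeChartGaussian (siteDist_comm)
open CubeTwoCentre (siteDist_triangle)

variable {H : ℕ}

/-! ## Endpoints of two edges are within `2` of the base points -/

/-- If `z` is an endpoint of `ε` and `w` an endpoint of `ε'`, then `(1+d(z,w))⁻⁴ ≤ 81·(1+d(ε₋,ε'₋))⁻⁴`. -/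
theorem one_div_pow_four_le_of_endInd {ε ε' : ZdEdge 4} {z w : Site 4} (hz : endInd ε z ≠ 0) (hw : endInd ε' w ≠ 0) :
    1 / (1 + siteDist z w) ^ 4 ≤ 81 / (1 + siteDist ε.1 ε'.1) ^ 4 := by
  have h1 : siteDist z ε.1 ≤ 1 := siteDist_le_one_of_endInd_ne_zero hz
  have h2 : siteDist w ε'.1 ≤ 1 := siteDist_le_one_of_endInd_ne_zero hw
  have hd0 := GhostKernel.siteDist_nonneg z w
  have he0 := GhostKernel.siteDist_nonneg ε.1 ε'.1
  have h3 : siteDist ε.1 ε'.1 ≤ siteDist z ε.1 + siteDist z ε'.1 := siteDist_triangle z ε.1 ε'.1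
  have h4 : siteDist z ε'.1 ≤ siteDist w z + siteDist w ε'.1 := siteDist_triangle w z ε'.1
  rw [siteDist_comm w z] at h4
  have h5 : 1 + siteDist ε.1 ε'.1 ≤ 3 * (1 + siteDist z w) := by linarith
  rw [div_le_div_iff₀ (by positivity) (by positivity), one_mul]
  calc (1 + siteDist ε.1 ε'.1) ^ 4 ≤ (3 * (1 + siteDist z w)) ^ 4 := pow_le_pow_left₀ (by linarith) h5 4
    _ = 81 * (1 + siteDist z w) ^ 4 := by ring

/-- `Σ_{z,w ∈ interiorSites H} endInd_ε(z)·endInd_ε'(w)/(1+d(z,w))⁴ ≤ 324/(1+d(ε₋,ε'₋))⁴`. -/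
theorem sum_endInd_mul_endInd_div_le (ε ε' : ZdEdge 4) :
    ∑ z : ↥(interiorSites H), ∑ w : ↥(interiorSites H),
        endInd ε (z : Site 4) * endInd ε' (w : Site 4) / (1 + siteDist (z : Site 4) (w : Site 4)) ^ 4 ≤
      324 / (1 + siteDist ε.1 ε'.1) ^ 4 := by
  have he0 := GhostKernel.siteDist_nonneg ε.1 ε'.1
  have hK : 0 ≤ 81 / (1 + siteDist ε.1 ε'.1) ^ 4 := by positivity
  have hterm : ∀ z w : ↥(interiorSites H),
      endInd ε (z : Site 4) * endInd ε' (w : Site 4) / (1 + siteDist (z : Site 4) (w : Site 4)) ^ 4 ≤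
        endInd ε (z : Site 4) * endInd ε' (w : Site 4) * (81 / (1 + siteDist ε.1 ε'.1) ^ 4) := by
    intro z w
    by_cases hz : endInd ε (z : Site 4) = 0
    · rw [hz]; simp
    by_cases hw : endInd ε' (w : Site 4) = 0
    · rw [hw]; simp
    have h := one_div_pow_four_le_of_endInd hz hw
    have he := mul_nonneg (endInd_nonneg ε (z : Site 4)) (endInd_nonneg ε' (w : Site 4))
    calc endInd ε (z : Site 4) * endInd ε' (w : Site 4) / (1 + siteDist (z : Site 4) (w : Site 4)) ^ 4
        = endInd ε (z : Site 4) * endInd ε' (w : Site 4) * (1 / (1 + siteDist (z : Site 4) (w : Site 4)) ^ 4) := by ring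
      _ ≤ _ := mul_le_mul_of_nonneg_left h he
  have hz2 : ∑ z : ↥(interiorSites H), endInd ε (z : Site 4) ≤ 2 := sum_endInd_le ε
  have hw2 : ∑ w : ↥(interiorSites H), endInd ε' (w : Site 4) ≤ 2 := sum_endInd_le ε'
  have hz0 : 0 ≤ ∑ z : ↥(interiorSites H), endInd ε (z : Site 4) := Finset.sum_nonneg fun z _ => endInd_nonneg _ _
  have hw0 : 0 ≤ ∑ w : ↥(interiorSites H), endInd ε' (w : Site 4) := Finset.sum_nonneg fun w _ => endInd_nonneg _ _
  calc ∑ z : ↥(interiorSites H), ∑ w : ↥(interiorSites H),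
        endInd ε (z : Site 4) * endInd ε' (w : Site 4) / (1 + siteDist (z : Site 4) (w : Site 4)) ^ 4
      ≤ ∑ z : ↥(interiorSites H), ∑ w : ↥(interiorSites H),
          endInd ε (z : Site 4) * endInd ε' (w : Site 4) * (81 / (1 + siteDist ε.1 ε'.1) ^ 4) :=
        Finset.sum_le_sum fun z _ => Finset.sum_le_sum fun w _ => hterm z w
    _ = (∑ z : ↥(interiorSites H), endInd ε (z : Site 4)) * (∑ w : ↥(interiorSites H), endInd ε' (w : Site 4)) *
          (81 / (1 + siteDist ε.1 ε'.1) ^ 4) := by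
        have hin : ∀ z : ↥(interiorSites H), ∑ w : ↥(interiorSites H),
            endInd ε (z : Site 4) * endInd ε' (w : Site 4) * (81 / (1 + siteDist ε.1 ε'.1) ^ 4) =
            endInd ε (z : Site 4) * (∑ w : ↥(interiorSites H), endInd ε' (w : Site 4)) * (81 / (1 + siteDist ε.1 ε'.1) ^ 4) :=
          fun z => by rw [Finset.mul_sum, Finset.sum_mul]
        rw [Finset.sum_congr rfl fun z _ => hin z, ← Finset.sum_mul, ← Finset.sum_mul]
    _ ≤ 2 * 2 * (81 / (1 + siteDist ε.1 ε'.1) ^ 4) := by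
        refine mul_le_mul_of_nonneg_right ?_ hK
        exact mul_le_mul hz2 hw2 hw0 (by norm_num)
    _ = 324 / (1 + siteDist ε.1 ε'.1) ^ 4 := by ring

/-! ## The entries of `M_H` -/

/-- **Entries of `M_H`, explicit constants**: `|M_H(i,j)| ≤ 1492992·C_G²·Σ_{z,w} endInd_i(z)endInd_j(w)/(1+d(z,w))⁴ + [i=j]·144·C_G`. -/
theorem abs_ghostM_le_endInd_of (hG0 : ∀ x z : ↥(interiorSites H), 0 ≤ (dirichletMatrix (interiorSites H))⁻¹ x z) {CG : ℝ}
    (hCG : 0 ≤ CG)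
    (hGd : ∀ x z : ↥(interiorSites H), (dirichletMatrix (interiorSites H))⁻¹ x z ≤ CG / (1 + siteDist (x : Site 4) (z : Site 4)) ^ 2)
    (i j : LandauFree H × Fin 3) :
    |ghostM H i j| ≤ 1492992 * CG ^ 2 * ∑ z : ↥(interiorSites H), ∑ w : ↥(interiorSites H),
        endInd i.1.1.1 (z : Site 4) * endInd j.1.1.1 (w : Site 4) / (1 + siteDist (z : Site 4) (w : Site 4)) ^ 4 +
      (if i = j then 144 * CG else 0) := by
  have hGC : ∀ x z : ↥(interiorSites H), (dirichletMatrix (interiorSites H))⁻¹ x z ≤ CG := by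
    intro x z
    refine (hGd x z).trans (div_le_self hCG ?_)
    have hd := GhostKernel.siteDist_nonneg (x : Site 4) (z : Site 4)
    exact one_le_pow₀ (by linarith)
  -- the pairing term
  set S : ℝ := ∑ z : ↥(interiorSites H), ∑ w : ↥(interiorSites H),
    endInd i.1.1.1 (z : Site 4) * endInd j.1.1.1 (w : Site 4) / (1 + siteDist (z : Site 4) (w : Site 4)) ^ 4 with hS
  have hS0 : 0 ≤ S := Finset.sum_nonneg fun z _ => Finset.sum_nonneg fun w _ => by
    have := endInd_nonneg i.1.1.1 (z : Site 4); have := endInd_nonneg j.1.1.1 (w : Site 4)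
    have := GhostKernel.siteDist_nonneg (z : Site 4) (w : Site 4); positivity
  have hpair : |(ghostX H (basisLinkL H i) * ghostX H (basisLinkL H j)).trace| ≤ 2985984 * CG ^ 2 * S := by
    have h := abs_trace_ghostX_edgeMat_mul_le hG0 hCG hGd i.1.1.1 j.1.1.1 (su2Coord (Pi.single i.2 (1 : ℝ)))
      (su2Coord (Pi.single j.2 (1 : ℝ)))
    have hn := mul_le_mul (norm_su2Coord_single_le i.2) (norm_su2Coord_single_le j.2) (norm_nonneg _) (by norm_num)
    calc |(ghostX H (basisLinkL H i) * ghostX H (basisLinkL H j)).trace|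
        ≤ 331776 * ‖su2Coord (Pi.single i.2 (1 : ℝ))‖ * ‖su2Coord (Pi.single j.2 (1 : ℝ))‖ * CG ^ 2 * S := h
      _ = 331776 * (‖su2Coord (Pi.single i.2 (1 : ℝ))‖ * ‖su2Coord (Pi.single j.2 (1 : ℝ))‖) * (CG ^ 2 * S) := by ring
      _ ≤ 331776 * (3 * 3) * (CG ^ 2 * S) :=
          mul_le_mul_of_nonneg_right (mul_le_mul_of_nonneg_left hn (by norm_num)) (mul_nonneg (sq_nonneg _) hS0)
      _ = 2985984 * CG ^ 2 * S := by ring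
  -- the diagonal term
  have hQ : |(ghostX H (basisLinkQ H i.1)).trace| ≤ 288 * CG := by
    have h := abs_trace_ghostX_edgeMat_le hG0 hCG hGC i.1.1.1 (1 : Matrix (Fin 2) (Fin 2) ℂ)
    rw [norm_one, mul_one] at h
    exact h
  rw [ghostM_apply]
  by_cases hij : i = j
  · rw [if_pos hij, if_pos hij]
    calc _ ≤ |-(1 / 2) * (ghostX H (basisLinkL H i) * ghostX H (basisLinkL H j)).trace| +
          |1 / 2 * (ghostX H (basisLinkQ H i.1)).trace| := abs_sub _ _
      _ ≤ 1492992 * CG ^ 2 * S + 144 * CG := by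
          rw [abs_mul, abs_mul, abs_neg, abs_of_pos (by norm_num : (0 : ℝ) < 1 / 2)]
          linarith
  · rw [if_neg hij, if_neg hij, sub_zero, abs_mul, abs_neg, abs_of_pos (by norm_num : (0 : ℝ) < 1 / 2), add_zero]
    linarith

/-- **Entries of `M_H` in endpoint form**: `∃ C ≥ 0, ∀ H ≥ 1, |M_H(i,j)| ≤ C·Σ_{z,w} endInd_i(z)endInd_j(w)/(1+d(z,w))⁴ + [i=j]·C`. -/
theorem abs_ghostM_le_endInd : ∃ C : ℝ, 0 ≤ C ∧ ∀ H : ℕ, 1 ≤ H → ∀ i j : LandauFree H × Fin 3,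
    |ghostM H i j| ≤ C * ∑ z : ↥(interiorSites H), ∑ w : ↥(interiorSites H),
        endInd i.1.1.1 (z : Site 4) * endInd j.1.1.1 (w : Site 4) / (1 + siteDist (z : Site 4) (w : Site 4)) ^ 4 +
      (if i = j then C else 0) := by
  obtain ⟨CG₀, hK⟩ := ghostKernelDecay
  set CG : ℝ := max CG₀ 0 with hCGdef
  have hCG : 0 ≤ CG := le_max_right _ _
  refine ⟨max (1492992 * CG ^ 2) (144 * CG), le_max_of_le_left (by positivity), fun H hH i j => ?_⟩
  have hG0 : ∀ x z : ↥(interiorSites H), 0 ≤ (dirichletMatrix (interiorSites H))⁻¹ x z := fun x z => (hK H hH x z).1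
  have hGd : ∀ x z : ↥(interiorSites H), (dirichletMatrix (interiorSites H))⁻¹ x z ≤
      CG / (1 + siteDist (x : Site 4) (z : Site 4)) ^ 2 := by
    intro x z
    refine (hK H hH x z).2.trans ?_
    have := GhostKernel.siteDist_nonneg (x : Site 4) (z : Site 4)
    exact div_le_div_of_nonneg_right (le_max_left _ _) (by positivity)
  have h := abs_ghostM_le_endInd_of hG0 hCG hGd i j
  have hS0 : 0 ≤ ∑ z : ↥(interiorSites H), ∑ w : ↥(interiorSites H),
      endInd i.1.1.1 (z : Site 4) * endInd j.1.1.1 (w : Site 4) / (1 + siteDist (z : Site 4) (w : Site 4)) ^ 4 :=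
    Finset.sum_nonneg fun z _ => Finset.sum_nonneg fun w _ => by
      have := endInd_nonneg i.1.1.1 (z : Site 4); have := endInd_nonneg j.1.1.1 (w : Site 4)
      have := GhostKernel.siteDist_nonneg (z : Site 4) (w : Site 4); positivity
  refine h.trans (add_le_add (mul_le_mul_of_nonneg_right (le_max_left _ _) hS0) ?_)
  split_ifs
  · exact le_max_right _ _
  · exact le_rfl

/-- ★ **`GhostKernelEntries`**: `∃ C ≥ 0, ∀ H ≥ 1, ∀ i j, |M_H(i,j)| ≤ C/(1 + d(base i, base j))⁴`, `base i = (i.1 : edge).1` the base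
point of the edge carrying the chart coordinate `i`, `d` the sup-distance `siteDist`. -/
theorem abs_ghostM_le : ∃ C : ℝ, 0 ≤ C ∧ ∀ H : ℕ, 1 ≤ H → ∀ i j : LandauFree H × Fin 3,
    |ghostM H i j| ≤ C / (1 + siteDist (i.1.1.1).1 (j.1.1.1).1) ^ 4 := by
  obtain ⟨C, hC0, h⟩ := abs_ghostM_le_endInd
  refine ⟨C * 324 + C, by positivity, fun H hH i j => ?_⟩
  have hd0 := GhostKernel.siteDist_nonneg (i.1.1.1).1 (j.1.1.1).1
  have h1 := h H hH i j
  have h2 := sum_endInd_mul_endInd_div_le (H := H) i.1.1.1 j.1.1.1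
  have hdiag : (if i = j then C else 0) ≤ C / (1 + siteDist (i.1.1.1).1 (j.1.1.1).1) ^ 4 := by
    split_ifs with hij
    · subst hij
      have hz : siteDist (i.1.1.1).1 (i.1.1.1).1 = 0 := by
        have h0 : siteDist (i.1.1.1).1 (i.1.1.1).1 ≤ 0 :=
          CubeTwoCentre.siteDist_le_of_forall _ _ fun k => by simp
        linarith [GhostKernel.siteDist_nonneg (i.1.1.1).1 (i.1.1.1).1]
      rw [hz]; simp
    · positivity
  calc |ghostM H i j| ≤ C * _ + (if i = j then C else 0) := h1
    _ ≤ C * (324 / (1 + siteDist (i.1.1.1).1 (j.1.1.1).1) ^ 4) + C / (1 + siteDist (i.1.1.1).1 (j.1.1.1).1) ^ 4 :=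
        add_le_add (mul_le_mul_of_nonneg_left h2 hC0) hdiag
    _ = (C * 324 + C) / (1 + siteDist (i.1.1.1).1 (j.1.1.1).1) ^ 4 := by ring

end GhostFP

end Summit.QuantumFields.YangMills.Theorems.AllWindowsColdBoxBoxHighLine

end
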